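import Summits.CriticalPhenomena.PercolationContinuityZ3.Theorems.PercNearOneGluingNoHeavyLowerTailAntitheticApexMixed
import Summits.CriticalPhenomena.PercolationContinuityZ3.Theorems.PercNearOneGluingNoHeavyLowerTailAntitheticLatticePieces
import HarnessLib

/-!
# `NoHeavyLowerTail` (stmt-CriticalPhenomena-4575) — antithetic cluster pairs: **COMPARABLE CLUSTERS ⇒ ⊕-POSITIVE**, and **every COMPLETE
# GRAPH `K_n` is ⊕-positive from every vertex to every target** (prim-hp-2 gen 64, HOME/MEMO-gen64.md §3bis)

Support file (`--supports stmt-CriticalPhenomena-4575`, hull-port prover `prim-hp-2`, gen 64).  No definitions, no named facts, no sorries;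
standard axioms.  VERTEX version; `X_E T = openCluster (T ∩ E) s` (red cluster), `Y_E T = openCluster (Tᶜ ∩ E) s` (blue cluster);
𝒮 = twisted-monotone super-odd test functions; `(E, s, P)` is ⊕-POSITIVE if `Σ_{T : P ∈ X_E T} K₁K₂(X_E T, Y_E T) ≥ 0` for all `K₁, K₂ ∈ 𝒮`.

* `Antithetic.Comparable.oplus_nonneg` — **COMPARABILITY PRINCIPLE.**  If for EVERY colouring the two clusters are comparable
  (`X T ⊆ Y T` or `Y T ⊆ X T`), then `(E, s, P)` is ⊕-positive for EVERY `P`.  Certificate: the colourings with `P ∈ X` split into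
  nested ones (`Y ⊆ X`: 0-cubes, `Cherry.zero_cube_nonneg`) and anti-nested ones `X ⊆ Y`, each of which is paired with its COMPLEMENT
  colouring (`(X,Y) ↦ (Y,X)`, again in the event since `P ∈ X ⊆ Y`): a red-dominated 1-cube (`Cherry.one_cube_nonneg`:
  `K(Y,X) ≥ |K(X,Y)|`).  Assembled with the partition principle `Antithetic.sum_nonneg_of_parts` (parts `{T, Tᶜ} ∩ event`).
* `Antithetic.Complete.comparable` — in a 2-colouring of the COMPLETE graph on a vertex set `W ∋ s` (edge set: all non-diagonal pairs inside
  `W`) the red and blue clusters of `s` are comparable: if some `u ∈ W` is not red-reached then `su` and every `vu` (`v` red-reached) are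
  blue, so everything red-reached is blue-reached.  [the folklore fact "one colour class of a 2-coloured `K_n` is connected", seen from `s`]
* `Antithetic.Complete.oplus_nonneg` — hence **`K_n` IS ⊕-POSITIVE** for every `n`, every source and every target (`λ(s,P) = n − 1`; no box
  partition exists for `n ≥ 4`): an INFINITE non-boxable family with a STRUCTURAL two-piece certificate.  With the apex lemma
  (…AntitheticApexMixed) and the dual handle theorem (…AntitheticHandleDual) it gives `K_n + handle` for all `n` (…AntitheticCompleteHandle);
  the checked certificates …AntitheticK4Oplus / …K5Oplus are the cases `n = 4, 5`.
* (appended) `Antithetic.Clique.comparable`, `Antithetic.Clique.oplus_nonneg` — the same for a CLIQUE WITH AN ARBITRARILY ATTACHED SOURCE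
  (only the vertices other than `s` need to be pairwise joined: `K_{m+1}` minus any pairs at `s`).
[cite: VandenbergHaggstromKahn2005, §1 p. 6 ("Harris' inequality"), §1 p. 3 (open cluster `C_s`)]
-/

noncomputable section

namespace Summit.CriticalPhenomena.PercolationContinuityZ3.Theorems

open Literature.Probability.Percolation
open scoped Classical

namespace Antithetic

namespace Comparable

variable {V : Type*} [Fintype V] {E : Set (Sym2 V)} {s : V}

/-- **Comparability principle.**  If the red and blue clusters of `s` are comparable in every colouring, then for every `P` and all
twisted-monotone super-odd `K₁, K₂`: `0 ≤ Σ_{T : P ∈ X_E T} K₁ (X_E T) (Y_E T) * K₂ (X_E T) (Y_E T)`. [this work] -/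
theorem oplus_nonneg (hcomp : ∀ T : Set (Sym2 V), openCluster (T ∩ E) s ⊆ openCluster (Tᶜ ∩ E) s ∨ openCluster (Tᶜ ∩ E) s ⊆ openCluster (T ∩ E) s)
    (P : V) (K₁ K₂ : Set V → Set V → ℝ)
    (hK₁ : ∀ ⦃A A' B B' : Set V⦄, A ⊆ A' → B' ⊆ B → K₁ A B ≤ K₁ A' B') (hso₁ : ∀ A B, 0 ≤ K₁ A B + K₁ B A)
    (hK₂ : ∀ ⦃A A' B B' : Set V⦄, A ⊆ A' → B' ⊆ B → K₂ A B ≤ K₂ A' B') (hso₂ : ∀ A B, 0 ≤ K₂ A B + K₂ B A) :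
    0 ≤ ∑ T ∈ Finset.univ.filter (fun T : Set (Sym2 V) => P ∈ openCluster (T ∩ E) s),
      K₁ (openCluster (T ∩ E) s) (openCluster (Tᶜ ∩ E) s) * K₂ (openCluster (T ∩ E) s) (openCluster (Tᶜ ∩ E) s) := by
  let X : Set (Sym2 V) → Set V := fun T => openCluster (T ∩ E) s
  let Y : Set (Sym2 V) → Set V := fun T => openCluster (Tᶜ ∩ E) s
  let D : Finset (Set (Sym2 V)) := Finset.univ.filter fun T : Set (Sym2 V) => P ∈ X T
  let Ψ : Set (Sym2 V) → ℝ := fun T => K₁ (X T) (Y T) * K₂ (X T) (Y T)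
  -- the clusters of the complement colouring
  have hXc : ∀ T : Set (Sym2 V), X Tᶜ = Y T := fun T => rfl
  have hYc : ∀ T : Set (Sym2 V), Y Tᶜ = X T := fun T => by show openCluster (Tᶜᶜ ∩ E) s = _; rw [compl_compl]
  have hmemD : ∀ T : Set (Sym2 V), T ∈ D ↔ P ∈ X T := fun T => by simp only [D, Finset.mem_filter, Finset.mem_univ, true_and]
  -- parts: `{T, Tᶜ} ∩ D`
  let Pt : Set (Sym2 V) → Finset (Set (Sym2 V)) := fun T => ({T, Tᶜ} : Finset (Set (Sym2 V))).filter fun M => M ∈ D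
  show 0 ≤ ∑ T ∈ D, Ψ T
  refine sum_nonneg_of_parts D Ψ Pt ?_ ?_ ?_ ?_
  · intro T hT
    exact Finset.mem_filter.2 ⟨Finset.mem_insert_self _ _, hT⟩
  · intro T _ M hM
    exact (Finset.mem_filter.1 hM).2
  · intro T _ M hM
    have hM' := (Finset.mem_filter.1 hM).1
    rw [Finset.mem_insert, Finset.mem_singleton] at hM'
    rcases hM' with rfl | rfl
    · rfl
    · show ({Tᶜ, Tᶜᶜ} : Finset (Set (Sym2 V))).filter (fun M => M ∈ D) = ({T, Tᶜ} : Finset (Set (Sym2 V))).filter fun M => M ∈ D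
      rw [compl_compl, Finset.pair_comm]
  · intro T hT
    have hPX : P ∈ X T := (hmemD T).1 hT
    by_cases hc : Tᶜ ∈ D
    · -- both `T` and `Tᶜ` in the event: a red-dominated 1-cube
      have hne : T ≠ Tᶜ := by
        intro h
        have h1 : s(s, s) ∈ T ↔ s(s, s) ∈ Tᶜ := by rw [← h]
        rw [Set.mem_compl_iff] at h1
        exact iff_not_self h1
      have hPt : Pt T = {T, Tᶜ} := by
        ext M
        simp only [Pt, Finset.mem_filter, Finset.mem_insert, Finset.mem_singleton]
        constructor
        · exact fun h => h.1
        · rintro (rfl | rfl)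
          · exact ⟨Or.inl rfl, hT⟩
          · exact ⟨Or.inr rfl, hc⟩
      rw [hPt, Finset.sum_pair hne]
      show 0 ≤ K₁ (X T) (Y T) * K₂ (X T) (Y T) + K₁ (X Tᶜ) (Y Tᶜ) * K₂ (X Tᶜ) (Y Tᶜ)
      rw [hXc, hYc]
      rcases hcomp T with h | h
      · exact Cherry.one_cube_nonneg (X T) (Y T) (Y T) (X T) h h subset_rfl subset_rfl hK₁ hso₁ hK₂ hso₂
      · rw [add_comm]
        exact Cherry.one_cube_nonneg (Y T) (X T) (X T) (Y T) h h subset_rfl subset_rfl hK₁ hso₁ hK₂ hso₂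
    · -- only `T`: then `P ∉ Y T`, so `Y T ⊆ X T` (nested 0-cube)
      have hPt : Pt T = {T} := by
        ext M
        simp only [Pt, Finset.mem_filter, Finset.mem_insert, Finset.mem_singleton]
        constructor
        · rintro ⟨rfl | rfl, hM⟩
          · rfl
          · exact absurd hM hc
        · rintro rfl; exact ⟨Or.inl rfl, hT⟩
      rw [hPt, Finset.sum_singleton]
      have hPY : P ∉ Y T := fun h => hc ((hmemD Tᶜ).2 (by rw [hXc]; exact h))
      have hYX : Y T ⊆ X T := by
        rcases hcomp T with h | h
        · exact absurd (h hPX) hPY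
        · exact h
      exact Cherry.zero_cube_nonneg _ _ hYX hK₁ hso₁ hK₂ hso₂

end Comparable

namespace Complete

variable {V : Type*} {W : Set V} {s : V} (hs : s ∈ W) {E : Set (Sym2 V)} (hE : E = {e | ¬ e.IsDiag ∧ ∀ v ∈ e, v ∈ W})
include hs hE

omit hs in
/-- A vertex reached from `s` in a sub-colouring of the complete graph on `W` is `s` or lies in `W`. [folklore] -/
theorem mem_of_reach (η : Set (Sym2 V)) {v : V} (hv : v ∈ openCluster (η ∩ E) s) (hvs : v ≠ s) : v ∈ W := by
  obtain ⟨w, hw, -⟩ := Glue.exists_pair_of_reachable (η ∩ E) (Ne.symm hvs ∘ Eq.symm) (SimpleGraph.Reachable.symm hv)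
  have hwE : s(v, w) ∈ E := hw.2
  rw [hE] at hwE
  exact hwE.2 v (Sym2.mem_mk_left _ _)

/-- **Comparability in complete graphs.**  For the complete graph on `W ∋ s` (all non-diagonal pairs inside `W`) and every colouring `T`,
`X T ⊆ Y T` or `Y T ⊆ X T`. [folklore: one colour class of a 2-coloured `K_n` spans] -/
theorem comparable (T : Set (Sym2 V)) :
    openCluster (T ∩ E) s ⊆ openCluster (Tᶜ ∩ E) s ∨ openCluster (Tᶜ ∩ E) s ⊆ openCluster (T ∩ E) s := by
  by_cases hall : ∀ u ∈ W, u ∈ openCluster (T ∩ E) s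
  · -- everything is red-reached
    right
    intro v hv
    by_cases hvs : v = s
    · rw [hvs]; exact mem_openCluster_self _ _
    · exact hall v (mem_of_reach hE Tᶜ hv hvs)
  · -- some `u ∈ W` is not red-reached: then every red-reached vertex is blue-reached through `u`
    left
    push Not at hall
    obtain ⟨u, huW, huX⟩ := hall
    have hus : u ≠ s := fun h => huX (h ▸ mem_openCluster_self _ _)
    have hsu : s(s, u) ∈ E := by rw [hE]; exact ⟨by rw [Sym2.mk_isDiag_iff]; exact hus.symm, fun v hv => by
      rcases Sym2.mem_iff.1 hv with rfl | rfl <;> assumption⟩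
    -- `su` is blue
    have hsuT : s(s, u) ∉ T := fun h => huX (((openGraph_adj (T ∩ E) s u).2 ⟨⟨h, hsu⟩, hus.symm⟩).reachable)
    have huY : u ∈ openCluster (Tᶜ ∩ E) s := ((openGraph_adj (Tᶜ ∩ E) s u).2 ⟨⟨hsuT, hsu⟩, hus.symm⟩).reachable
    intro v hv
    by_cases hvs : v = s
    · rw [hvs]; exact mem_openCluster_self _ _
    have hvW : v ∈ W := mem_of_reach hE T hv hvs
    have hvu : v ≠ u := fun h => huX (h ▸ hv)
    have hvuE : s(v, u) ∈ E := by rw [hE]; exact ⟨by rw [Sym2.mk_isDiag_iff]; exact hvu, fun w hw => by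
      rcases Sym2.mem_iff.1 hw with rfl | rfl <;> assumption⟩
    -- `vu` is blue (a red `vu` would reach `u`)
    have hvuT : s(v, u) ∉ T := fun h => huX (SimpleGraph.Reachable.trans hv ((openGraph_adj (T ∩ E) v u).2 ⟨⟨h, hvuE⟩, hvu⟩).reachable)
    have h2 : (openGraph (Tᶜ ∩ E)).Adj u v := by
      rw [openGraph_adj, Sym2.eq_swap]
      exact ⟨⟨hvuT, hvuE⟩, hvu.symm⟩
    exact SimpleGraph.Reachable.trans huY h2.reachable

variable [Fintype V]

/-- **Complete graphs are ⊕-positive**: for the complete graph on `W ∋ s`, every target `P` and all twisted-monotone super-odd `K₁, K₂`,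
`0 ≤ Σ_{T : P ∈ X T} K₁ (X T) (Y T) * K₂ (X T) (Y T)`. [this work] -/
theorem oplus_nonneg (P : V) (K₁ K₂ : Set V → Set V → ℝ)
    (hK₁ : ∀ ⦃A A' B B' : Set V⦄, A ⊆ A' → B' ⊆ B → K₁ A B ≤ K₁ A' B') (hso₁ : ∀ A B, 0 ≤ K₁ A B + K₁ B A)
    (hK₂ : ∀ ⦃A A' B B' : Set V⦄, A ⊆ A' → B' ⊆ B → K₂ A B ≤ K₂ A' B') (hso₂ : ∀ A B, 0 ≤ K₂ A B + K₂ B A) :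
    0 ≤ ∑ T ∈ Finset.univ.filter (fun T : Set (Sym2 V) => P ∈ openCluster (T ∩ E) s),
      K₁ (openCluster (T ∩ E) s) (openCluster (Tᶜ ∩ E) s) * K₂ (openCluster (T ∩ E) s) (openCluster (Tᶜ ∩ E) s) :=
  Comparable.oplus_nonneg (comparable hs hE) P K₁ K₂ hK₁ hso₁ hK₂ hso₂

end Complete

namespace Clique

/-! ### Appended (prim-hp-2 gen 64): a CLIQUE with an arbitrarily attached source

The comparability argument only needs the vertices OTHER than `s` to be pairwise adjacent: an incomparable colouring would contain
`u ∈ Y ∖ X` and `v ∈ X ∖ Y`, both `≠ s`, and the pair `uv` can be neither red (`u ∈ X`) nor blue (`v ∈ Y`).  So every graph whose vertices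
other than the source induce a clique — `K_m` with a new source joined to ANY nonempty set of its vertices, i.e. `K_{m+1}` minus any set of
pairs at `s` — is ⊕-positive from `s` to every target. -/

variable {V : Type*} {W : Set V} {s : V} {E : Set (Sym2 V)} (hEW : ∀ e ∈ E, ∀ v ∈ e, v ∈ W)
  (hclique : ∀ u ∈ W, ∀ v ∈ W, u ≠ s → v ≠ s → u ≠ v → s(u, v) ∈ E)
include hEW hclique

/-- **Comparability for a clique with an attached source**: if the pairs of `E` lie inside `W` and all vertices of `W` other than `s`
are pairwise joined, then in every colouring `X T ⊆ Y T` or `Y T ⊆ X T`. [this work] -/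
theorem comparable (T : Set (Sym2 V)) :
    openCluster (T ∩ E) s ⊆ openCluster (Tᶜ ∩ E) s ∨ openCluster (Tᶜ ∩ E) s ⊆ openCluster (T ∩ E) s := by
  by_contra h
  rw [not_or, Set.not_subset, Set.not_subset] at h
  obtain ⟨⟨v, hvX, hvY⟩, ⟨u, huY, huX⟩⟩ := h
  have hvs : v ≠ s := fun h => hvY (h ▸ mem_openCluster_self _ _)
  have hus : u ≠ s := fun h => huX (h ▸ mem_openCluster_self _ _)
  have huv : u ≠ v := fun h => huX (h ▸ hvX)
  -- `u, v` lie on pairs of `E`, hence in `W`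
  obtain ⟨w₁, hw₁, -⟩ := Glue.exists_pair_of_reachable (T ∩ E) (Ne.symm hvs ∘ Eq.symm) (SimpleGraph.Reachable.symm hvX)
  obtain ⟨w₂, hw₂, -⟩ := Glue.exists_pair_of_reachable (Tᶜ ∩ E) (Ne.symm hus ∘ Eq.symm) (SimpleGraph.Reachable.symm huY)
  have hvW : v ∈ W := hEW _ hw₁.2 v (Sym2.mem_mk_left _ _)
  have huW : u ∈ W := hEW _ hw₂.2 u (Sym2.mem_mk_left _ _)
  have huvE : s(u, v) ∈ E := hclique u huW v hvW hus hvs huv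
  by_cases hT : s(u, v) ∈ T
  · -- red: `u` would be red-reached from `v`
    have hadj : (openGraph (T ∩ E)).Adj v u := by
      rw [openGraph_adj, Sym2.eq_swap]; exact ⟨⟨hT, huvE⟩, huv.symm⟩
    exact huX (SimpleGraph.Reachable.trans hvX hadj.reachable)
  · -- blue: `v` would be blue-reached from `u`
    have hadj : (openGraph (Tᶜ ∩ E)).Adj u v := by
      rw [openGraph_adj]; exact ⟨⟨hT, huvE⟩, huv⟩
    exact hvY (SimpleGraph.Reachable.trans huY hadj.reachable)

variable [Fintype V]

/-- **A clique with an attached source is ⊕-positive** at every target. [this work] -/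
theorem oplus_nonneg (P : V) (K₁ K₂ : Set V → Set V → ℝ)
    (hK₁ : ∀ ⦃A A' B B' : Set V⦄, A ⊆ A' → B' ⊆ B → K₁ A B ≤ K₁ A' B') (hso₁ : ∀ A B, 0 ≤ K₁ A B + K₁ B A)
    (hK₂ : ∀ ⦃A A' B B' : Set V⦄, A ⊆ A' → B' ⊆ B → K₂ A B ≤ K₂ A' B') (hso₂ : ∀ A B, 0 ≤ K₂ A B + K₂ B A) :
    0 ≤ ∑ T ∈ Finset.univ.filter (fun T : Set (Sym2 V) => P ∈ openCluster (T ∩ E) s),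
      K₁ (openCluster (T ∩ E) s) (openCluster (Tᶜ ∩ E) s) * K₂ (openCluster (T ∩ E) s) (openCluster (Tᶜ ∩ E) s) :=
  Comparable.oplus_nonneg (comparable hEW hclique) P K₁ K₂ hK₁ hso₁ hK₂ hso₂

end Clique

end Antithetic

end Summit.CriticalPhenomena.PercolationContinuityZ3.Theorems
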